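import Summits.AnomalousDissipation.AnomalousDissipation.Theorems.SolenoidalFractalHomogenisationLagrangianStepOneLevelSplitDefs
import HarnessLib

/-!
# K1L_D `LagrangianRenormalisationStepDesign` (stmt-AnomalousDissipation-27980), stub `stub_oneLevelL_IW` v3-cut-2: the two extra DATA DEFINITIONS of the
# amended one-level cut (definitions only; K1L SHARED-DEFS rule (a); tenure D24-11, lead F-lead-4 / P3 and F-lead-7)

Sequel of `…LagrangianStepOneLevelSplitDefs` (p647662: `V2 datumLp grid cutLp vSeq uSeq`).  The lead's typing of S23′ showed (F-lead-4) that the LAST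
ledger window must be LONG — so the grid is `gridL` (windows `[jr,(j+1)r)` while the next full window still fits before `t`, the last window
absorbs the remainder and has length in `[r,2r)` when `r ≤ t`, degenerate windows `[t,t]` after it) instead of `grid r t k = min (k r) t` — and
(F-lead-7) that the level-`(m+1)` sequence must be UNCUT — so both ledger sequences are the ONE propagated sequence `seqL U x r t`
(`0 ↦ x`, `j+1 ↦ U 0 (gridL r t (j+1)) x`) of a datum class `x : V2` under a two-parameter propagator `U` (`u_j := seqL U^(m+1) x₁`,
`v_j := seqL U^m x₁`; no `cutLp`, no `N`).  Used by the amended stub text S23″ `stub_windowDefectL` of the reference file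
`Summits/AnomalousDissipation/AnomalousDissipation/Cruxes/LagrangianRenormalisationStep/OneLevelSplitSketch.lean` (rev6, planner ad-ideate-p4 g11) and
by the glue `…LagrangianStepOneLevelSplitGlueL` (`oneLevelL_IW_of_piecesL : S0′ → S23″ → stub_oneLevelL_IW`).  Elementary API:
`…LagrangianStepOneLevelSplitApiL`.  No theorem here; nothing about the crux, Onsager's conjecture or anomalous dissipation is claimed.
Text by planner seat `ad-ideate-p4` g11 (2026-08-28); landed by a prover seat (Summits/Theorems is prover-only, D-0016).
-/

set_option linter.dupNamespace false

noncomputable section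

namespace Summit.AnomalousDissipation.AnomalousDissipation.Theorems.SolenoidalFractalHomogenisation.LagrangianStep

open Literature.Analysis Literature.Analysis.FluidPDE Literature.Analysis.FunctionSpaces
open MeasureTheory

/-- The LONG-LAST-WINDOW grid at terminal time `t` for window length `r` (lead F-lead-4 / P3): `w_0 = 0`; for `k ≥ 1`, `w_k = k·r` as long as the
NEXT full window still fits (`(k+1)·r ≤ t`), else `w_k = t` — so the windows are `[jr,(j+1)r)` and the LAST one absorbs the remainder (length in
`[r, 2r)` when `r ≤ t`); the windows after it are degenerate `[t,t]`. -/
def gridL (r t : ℝ) (k : ℕ) : ℝ :=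
  if k = 0 then 0 else if ((k : ℝ) + 1) * r ≤ t then (k : ℝ) * r else t

/-- The propagated sequence of a datum class `x` along the `gridL` of `t` under a two-parameter propagator `U`: `0 ↦ x`, `j+1 ↦ U 0 w_{j+1} x`
(lead F-lead-7: the level-`(m+1)` sequence `u_j := seqL U^{m+1} x₁` is UNCUT; the exact sequence is `v_j := seqL U^m x₁`). -/
def seqL (U : ℝ → ℝ → (V2 →L[ℝ] V2)) (x : V2) (r t : ℝ) : ℕ → V2
  | 0 => x
  | (j + 1) => U 0 (gridL r t (j + 1)) x

end Summit.AnomalousDissipation.AnomalousDissipation.Theorems.SolenoidalFractalHomogenisation.LagrangianStep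

end
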